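import Literature.Probability.RandomPlanarGeometry.SLERestrictionHitPathAccess
import Literature.Probability.RandomPlanarGeometry.ArcHullInterior
import Literature.Probability.RandomPlanarGeometry.RestrictionHullsRiemannProofs
import Literature.Analysis.Complex.SymmetricRiemannMap
import Literature.Analysis.Complex.SimplyConnectedOfCompl
import HarnessLib

/-!
# Discharge of `IsArcHull.exists_accessArc`: interior points are accessible from the base

The named fact `IsArcHull.exists_accessArc` (`SLERestrictionHitPathAccess`) is PROVED here
(`IsArcHull.exists_accessArc_holds`): for a hull `A` bounded by a Jordan arc and `p ∈ int A`,
there is a simple arc from a real base point of `A` to `p` through `int A`. Construction: the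
half-disc Riemann map `F : int A → 𝔻⁺` based at a real point `x_b` of the base of `A`
(`Complex.exists_bijOn_halfDisc`, `SymmetricRiemannMap`; `int A` is open, connected
(`IsArcHull.isPreconnected_interior`), has the square-root property, and contains the upper
half of a disc about `x_b`, `IsArcHull.exists_sides_interior_eq`); the arc is the image under
`F⁻¹` of the straight segment from `0` to `F p`, which lies in `𝔻⁺` except for its real
endpoint.

Supporting facts: `IsBoundedHull.isPreconnected_compl` (the complement of a bounded hull is
connected) and `IsArcHull.hasSqrt_interior`.
-/

noncomputable section

open Set Filter Metric Complex Bornology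
open _root_.Topology
open UpperHalfPlane (upperHalfPlaneSet isOpen_upperHalfPlaneSet)
open scoped ComplexConjugate

namespace Literature.Probability.RandomPlanarGeometry

/-- **The complement of a bounded hull is connected**: `ℍ ∖ A` is connected, the open lower
half-plane is connected, a far-right vertical pair of points links them through a right
half-plane missing `A`, and every real point off `A` is the centre of a disc missing `A`.
[folklore] -/
theorem IsBoundedHull.isPreconnected_compl {A : Set ℂ} (hA : IsBoundedHull A) : IsPreconnected Aᶜ := by
  obtain ⟨R, hR⟩ := hA.1.subset_ball 0
  set R' : ℝ := max R 0 + 1 with hR'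
  have hAR : ∀ z ∈ A, ‖z‖ < R' := fun z hz ↦ by
    have := mem_ball_zero_iff.1 (hR hz); rw [hR']; linarith [le_max_left R 0]
  set E : Set ℂ := {z : ℂ | R' < z.re} with hE
  have hEA : E ⊆ Aᶜ := fun z hz hzA ↦ by
    have h1 := hAR z hzA
    have h2 : z.re ≤ ‖z‖ := Complex.re_le_norm z
    exact absurd (lt_of_lt_of_le hz h2) (not_lt.2 h1.le)
  set S₁ : Set ℂ := upperHalfPlaneSet \ A with hS₁
  set S₂ : Set ℂ := {z : ℂ | z.im < 0} with hS₂
  have hS₂A : S₂ ⊆ Aᶜ := fun z hz hzA ↦ by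
    have : 0 ≤ z.im := by
      have := hA.subset_closure hzA
      rw [show upperHalfPlaneSet = {w : ℂ | 0 < w.im} from rfl, Complex.closure_setOf_lt_im] at this
      exact this
    exact absurd (show z.im < 0 from hz) (not_lt.2 this)
  set b : ℂ := ((R' + 1 : ℝ) : ℂ) - Complex.I with hb
  have hbS₂ : b ∈ S₂ := by show b.im < 0; simp [hb]
  have hbE : b ∈ E := by show R' < b.re; simp [hb]
  -- the big connected piece `S₁ ∪ E ∪ S₂`
  have hbig : IsPreconnected (S₁ ∪ E ∪ S₂) := by
    have hE' : IsPreconnected E := (convex_halfSpace_re_gt R').isPreconnected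
    have h1 : IsPreconnected (S₁ ∪ E) := by
      set a : ℂ := ((R' + 1 : ℝ) : ℂ) + Complex.I with ha
      have haS₁ : a ∈ S₁ := by
        refine ⟨show 0 < a.im by simp [ha], fun haA ↦ ?_⟩
        have h1 := hAR a haA
        have h2 : a.re ≤ ‖a‖ := Complex.re_le_norm a
        have h3 : a.re = R' + 1 := by simp [ha]
        linarith
      have haE : a ∈ E := by show R' < a.re; simp [ha]
      exact IsPreconnected.union a haS₁ haE hA.isPreconnected_diff hE'
    exact IsPreconnected.union b (Or.inr hbE) hbS₂ h1 (convex_halfSpace_im_lt 0).isPreconnected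
  have hbigA : S₁ ∪ E ∪ S₂ ⊆ Aᶜ := union_subset (union_subset (fun z hz ↦ hz.2) hEA) hS₂A
  refine isPreconnected_of_forall b fun z hz ↦ ?_
  by_cases hzim : z.im < 0
  · exact ⟨S₁ ∪ E ∪ S₂, hbigA, Or.inr hbS₂, Or.inr hzim, hbig⟩
  by_cases hzim' : 0 < z.im
  · exact ⟨S₁ ∪ E ∪ S₂, hbigA, Or.inr hbS₂, Or.inl (Or.inl ⟨hzim', hz⟩), hbig⟩
  · -- `z` real, off the closed set `A`: a disc about `z` misses `A` and meets `S₂`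
    have hzreal : z.im = 0 := le_antisymm (not_lt.1 hzim') (not_lt.1 hzim)
    obtain ⟨r, hr, hball⟩ := Metric.isOpen_iff.1 hA.isClosed.isOpen_compl z hz
    set z' : ℂ := z - ((r / 2 : ℝ) : ℂ) * Complex.I with hz'
    have hz'ball : z' ∈ ball z r := by
      rw [mem_ball, dist_eq_norm, hz', sub_sub_cancel_left, norm_neg, norm_mul, Complex.norm_real,
        Complex.norm_I, mul_one, Real.norm_eq_abs, abs_of_pos (by positivity)]
      linarith
    have hz'S₂ : z' ∈ S₂ := by show z'.im < 0; simp [hz', hzreal]; positivity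
    refine ⟨ball z r ∪ (S₁ ∪ E ∪ S₂), union_subset hball hbigA, Or.inr (Or.inr hbS₂),
      Or.inl (mem_ball_self hr), ?_⟩
    exact IsPreconnected.union z' hz'ball (Or.inr hz'S₂) (convex_ball z r).isPreconnected hbig

/-- **The interior of an arc hull has the square-root property** (it is open and connected,
and its complement `closure (ℂ ∖ A)` is connected and unbounded). [folklore] -/
theorem IsArcHull.hasSqrt_interior {A : Set ℂ} (hA : IsArcHull A) : Complex.HasSqrt (interior A) := by
  refine Complex.hasSqrt_of_compl isOpen_interior hA.isPreconnected_interior fun a ha hbd ↦ ?_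
  have hcompl : (interior A)ᶜ = closure Aᶜ := (closure_compl).symm
  have hconn : IsPreconnected (interior A)ᶜ := by
    rw [hcompl]; exact hA.isBoundedHull.isPreconnected_compl.closure
  have hsub : (interior A)ᶜ ⊆ connectedComponentIn (interior A)ᶜ a :=
    hconn.subset_connectedComponentIn ha subset_rfl
  -- the lower half-plane lies in the complement and is unbounded
  have hlow : {z : ℂ | z.im < 0} ⊆ (interior A)ᶜ := by
    intro z hz hzint
    have := hA.isBoundedHull.interior_subset hzint
    exact absurd (show 0 < z.im from this) (not_lt.2 (le_of_lt hz))
  have h1 : IsBounded {z : ℂ | z.im < 0} := hbd.subset (hlow.trans hsub)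
  obtain ⟨R, hR⟩ := h1.subset_closedBall 0
  set z : ℂ := -(((|R| + 1 : ℝ) : ℂ) * Complex.I) with hz
  have hzmem : z ∈ {z : ℂ | z.im < 0} := by
    show z.im < 0
    rw [hz]; simp only [neg_im, mul_im, Complex.ofReal_re, Complex.I_im, mul_one, Complex.ofReal_im,
      Complex.I_re, mul_zero, add_zero, neg_neg_iff_pos]
    positivity
  have hzn : ‖z‖ = |R| + 1 := by
    rw [hz, norm_neg, norm_mul, Complex.norm_real, Complex.norm_I, mul_one, Real.norm_eq_abs,
      abs_of_pos (by positivity)]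
  have := hR hzmem
  rw [mem_closedBall, dist_zero_right, hzn] at this
  linarith [le_abs_self R]

/-- **Discharge of the named fact `IsArcHull.exists_accessArc`**: every interior point of an arc
hull is joined to a real base point of the hull by a simple arc through the interior (the image
under the inverse half-disc Riemann map of a radius of `𝔻⁺`). [folklore] -/
theorem IsArcHull.exists_accessArc_holds : IsArcHull.exists_accessArc := by
  intro A hA p hp
  -- the base point and the half-disc about it
  obtain ⟨x₀, x₁, Us, hlt, hUso, -, -, hint, hbase⟩ := hA.exists_sides_interior_eq
  set xb : ℝ := (x₀ + x₁) / 2 with hxb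
  obtain ⟨hxbU, hxbA⟩ := hbase xb (by rw [hxb]; linarith) (by rw [hxb]; linarith)
  obtain ⟨r, hr, hball⟩ := Metric.isOpen_iff.1 hUso _ hxbU
  set U : Set ℂ := interior A with hU
  have hUo : IsOpen U := isOpen_interior
  have hUH : U ⊆ upperHalfPlaneSet := hA.isBoundedHull.interior_subset
  have hB : ball (xb : ℂ) r ∩ upperHalfPlaneSet ⊆ U := fun z hz ↦ by
    have : z ∈ Us ∩ upperHalfPlaneSet := ⟨hball hz.1, hz.2⟩
    rwa [← hint] at this
  obtain ⟨F, hFd, hbij, hinvd, hF0, -, htend⟩ :=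
    Complex.exists_bijOn_halfDisc hUo hA.isPreconnected_interior hA.hasSqrt_interior hUH hr hB
  set ψ : ℂ → ℂ := Function.invFunOn F U with hψ
  set b : ℂ := F p with hbdef
  have hbD : b ∈ ball (0 : ℂ) 1 ∩ upperHalfPlaneSet := hbij.mapsTo hp
  have hb1 : ‖b‖ < 1 := mem_ball_zero_iff.1 hbD.1
  have hbim : 0 < b.im := hbD.2
  have hb0 : b ≠ 0 := fun h ↦ by rw [h] at hbim; simp at hbim
  -- the radius `u ↦ u b` in `𝔻⁺`
  have hseg : ∀ u ∈ Ioc (0 : ℝ) 1, (u : ℂ) * b ∈ ball (0 : ℂ) 1 ∩ upperHalfPlaneSet := fun u hu ↦ by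
    refine ⟨?_, ?_⟩
    · rw [mem_ball_zero_iff, norm_mul, Complex.norm_real, Real.norm_eq_abs, abs_of_pos hu.1]
      calc u * ‖b‖ ≤ 1 * ‖b‖ := by gcongr; exact hu.2
        _ < 1 := by rw [one_mul]; exact hb1
    · show 0 < ((u : ℂ) * b).im
      rw [Complex.mul_im, Complex.ofReal_re, Complex.ofReal_im, zero_mul, add_zero]
      exact mul_pos hu.1 hbim
  have hψmem : ∀ w ∈ ball (0 : ℂ) 1 ∩ upperHalfPlaneSet, ψ w ∈ U ∧ F (ψ w) = w := fun w hw ↦ by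
    obtain ⟨z, hz, rfl⟩ := hbij.surjOn hw
    have hψz : ψ (F z) = z := hbij.injOn.leftInvOn_invFunOn hz
    exact ⟨by rw [hψz]; exact hz, by rw [hψz]⟩
  -- the path
  set η : ℝ → ℂ := fun u ↦ if u ≤ 0 then (xb : ℂ) else ψ ((u : ℂ) * b) with hη
  have hη0 : η 0 = xb := by simp [hη]
  have hηpos : ∀ u : ℝ, 0 < u → η u = ψ ((u : ℂ) * b) := fun u hu ↦ by simp [hη, not_le.2 hu]
  have hηint : ∀ u ∈ Ioc (0 : ℝ) 1, η u ∈ interior A := fun u hu ↦ by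
    rw [hηpos u hu.1]; exact (hψmem _ (hseg u hu)).1
  have hη1 : η 1 = p := by
    rw [hηpos 1 one_pos, Complex.ofReal_one, one_mul, hbdef, hψ]
    exact hbij.injOn.leftInvOn_invFunOn hp
  refine ⟨η, xb, ?_, ?_, hη0, hη1, hxbA, hηint⟩
  · -- continuity on `[0, 1]`
    intro u hu
    rcases hu.1.eq_or_lt with h0 | hpos
    · -- at `0`: `ψ(u b) → x_b`
      rw [← h0]
      rw [Metric.continuousWithinAt_iff]
      intro ε hε
      have ht := htend
      rw [Metric.tendsto_nhdsWithin_nhds] at ht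
      obtain ⟨δ, hδ, hδε⟩ := ht ε hε
      refine ⟨δ / ‖b‖, div_pos hδ (norm_pos_iff.2 hb0), fun v hv hvδ ↦ ?_⟩
      rw [hη0]
      rcases hv.1.eq_or_lt with hv0 | hvpos
      · rw [← hv0, hη0, dist_self]; exact hε
      · rw [hηpos v hvpos]
        refine hδε (hseg v ⟨hvpos, hv.2⟩) ?_
        rw [dist_zero_right, norm_mul, Complex.norm_real, Real.norm_eq_abs, abs_of_pos hvpos]
        rw [Real.dist_eq, sub_zero, abs_of_pos hvpos, lt_div_iff₀ (norm_pos_iff.2 hb0)] at hvδ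
        exact hvδ
    · -- at `u > 0`: locally `ψ (u b)`
      have hcont : ContinuousAt (fun v : ℝ ↦ ψ ((v : ℂ) * b)) u := by
        have h1 : ContinuousAt ψ ((u : ℂ) * b) :=
          (hinvd.continuousOn.continuousAt ((Complex.isOpen_ball_inter_upperHalfPlaneSet).mem_nhds (hseg u ⟨hpos, hu.2⟩)))
        have h2 : Continuous fun v : ℝ ↦ (v : ℂ) * b := by fun_prop
        exact ContinuousAt.comp (g := ψ) (f := fun v : ℝ ↦ (v : ℂ) * b) (x := u) h1 h2.continuousAt
      have heq : η =ᶠ[𝓝 u] fun v : ℝ ↦ ψ ((v : ℂ) * b) := by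
        filter_upwards [Ioi_mem_nhds hpos] with v hv
        exact hηpos v hv
      exact (hcont.congr_of_eventuallyEq heq).continuousWithinAt
  · -- injectivity on `[0, 1]`
    intro u hu v hv huv
    have hreal_ne : ∀ w ∈ Ioc (0 : ℝ) 1, η w ≠ xb := fun w hw h ↦ by
      have := hUH (hηint w hw)
      rw [h] at this
      exact absurd (show 0 < ((xb : ℝ) : ℂ).im from this) (by simp)
    rcases hu.1.eq_or_lt with hu0 | hupos <;> rcases hv.1.eq_or_lt with hv0 | hvpos
    · rw [← hu0, ← hv0]
    · exfalso; rw [← hu0, hη0] at huv; exact hreal_ne v ⟨hvpos, hv.2⟩ huv.symm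
    · exfalso; rw [← hv0, hη0] at huv; exact hreal_ne u ⟨hupos, hu.2⟩ huv
    · rw [hηpos u hupos, hηpos v hvpos] at huv
      have h1 := congrArg F huv
      rw [(hψmem _ (hseg u ⟨hupos, hu.2⟩)).2, (hψmem _ (hseg v ⟨hvpos, hv.2⟩)).2] at h1
      have h2 := mul_right_cancel₀ hb0 h1
      exact_mod_cast h2

end Literature.Probability.RandomPlanarGeometry
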